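import Literature.Barriers.BirchSwinnertonDyer.RankNotSumOfLocalInvariants
import Literature.NumberTheory.EllipticCurves.MordellCurveThreeDescent
import Mathlib.NumberTheory.Padics.Hensel
import Mathlib.NumberTheory.Padics.HeightOneSpectrum
import Mathlib.Analysis.SpecialFunctions.Pow.Real
import Mathlib.RingTheory.IntegralDomain
import Mathlib.NumberTheory.NumberField.InfinitePlace.TotallyRealComplex
import HarnessLib

/-!
# Rank mod `3` over the fixed field `ℚ`: nine cubic twists of `j = 0` form `3`-blocks at every place

Companion to `Literature/Barriers/BirchSwinnertonDyer/RankNotSumOfLocalInvariants.lean`, § Audit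
2026-08-15. The barrier entry
`Literature.Barriers.BirchSwinnertonDyer.DokchitserDokchitser2011_rankMod_notSumOfLocalInvariants`
(T. Dokchitser–V. Dokchitser, *A note on the Mordell–Weil rank modulo `n`*, J. Number Theory 131
(2011) 1833–1839, Thm. 2: "For `n ∈ {3,4,5}` the Mordell–Weil rank modulo `n` is not a sum of local
invariants") is obtained in print by Lemma 3 (Galois descent through `F₃ ⊂ ℚ(ζ₁₃, ζ₁₀₃)`). The
audit of the barrier file records a SECOND mechanism for `n = 3`, over the FIXED field `ℚ`
(evasions (iv), scope (b): "cubic twists inside `j = 0` give a Lemma-5-type relation over `ℚ` […]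
the nine curves `y² = x³ + D t²`, `t ∈ ⟨ℓ₁, ℓ₂⟩ ⊂ ℚ^×/ℚ^{×3}` […] have all local multiplicities in
`{3, 9}` at every place of `ℚ` […] so a `ℤ/3ℤ`-valued formula over `ℚ` forces
`Σ_t rk (y² = x³ + D t²)(ℚ) ≡ 0 (mod 3)`"; "not carried out in this audit"). This file PROVES
that mechanism for the concrete family

  `E_D : y² = x³ + t(D)²`, `t(a, b) = 2^a 5^b`, `D = (a, b) ∈ ℤ/3 × ℤ/3`

(`CubicTwist.curve`, nine Mordell curves `mordellCurve (t²)` over `ℚ`; `ℓ₁ = 2`, `ℓ₂ = 5`, `D = 1`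
in the audit's notation), in the format of the barrier file's abstract Lemma 5
(`Literature.Barriers.BirchSwinnertonDyer.not_isSumOfLocalInvariantsOver_of_blocks`):

* `CubicTwist.exists_variableChange`: `E_D ≅ E_{D'}` over any field `L ⊇ ℚ` in which
  `t(D)/t(D')` is a cube (`y² = x³ + s ≅ y² = x³ + s'` iff `s/s' ∈ L^{×6}`; here `s/s' = (t/t')²`
  and `−1` is a cube; Silverman X.5.4 for `j = 0`);
* at every prime `p` and at `∞` a subgroup of INDEX `≤ 3` of `V = ⟨2, 5⟩ ⊂ ℚ^×/ℚ^{×3}` consists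
  of local cubes (`CubicTwist.padic_ker_isCube`, `…real_ker_isCube`): `⟨5⟩` in `ℚ₂` and `⟨2⟩`
  in `ℚ₅` (every unit residue is a cube, `2 ≡ 5 ≡ 2 mod 3`), `⟨10⟩` in `ℚ₃`
  (`10 ≡ 100 ≡ 1 mod 9`), all of `V` in `ℝ`, and at every other prime the set of `D` with
  `t(D)` a cube modulo `p` — which contains a line because `𝔽_p^×` is CYCLIC, so that among
  `x, y, xy, xy²` one is always a cube (`CubicTwist.exists_cube_combination`); the residues are
  lifted by Hensel's lemma for `X³ − n` (Mathlib `hensels_lemma`; at `p = 3` from a root modulo `27`);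
* `CubicTwist.exists_blocks`: hence over any such `L` the nine curves fall into blocks (cosets of
  that subgroup) of size `3` or `9` of `L`-isomorphic curves, and
* `CubicTwist.not_isSumOfLocalInvariantsOver_rat_of_sum_ne_zero`: **a `ℤ/3ℤ`-valued invariant of
  Weierstrass curves over `ℚ` that is a sum of local invariants over the places of `ℚ` sums to `0`
  over the nine twists** (transport to the completions `ℚ_v ≅ ℚ_[p]`, `ℚ_∞ ≅ ℝ` as in
  `RankNotSumOfLocalInvariantsNarrowProofs.lean`); in particular
  (`CubicTwist.not_isSumOfLocalInvariants_rankMod_three_of_sum_ne_zero`) the K-UNIFORM case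
  `n = 3` of Theorem 2 follows from `Σ_D rk E_D(ℚ) ≢ 0 (mod 3)` (`IsSumOfLocalInvariants.over`).

The nine ranks (`rk = 0, 0, 0, 0, 1, 0, 1, 0, 0` for `t = 1, 2, 4, 5, 10, 20, 25, 50, 100`, sum `2`)
are the object of the sequel files (a `√−3`-descent over `ℚ(ζ₃)`); here they are not used.

Design notes. All combinatorics of the index group `ℤ/3 × ℤ/3` (fibres of the block maps,
multiplicativity of `t` up to cubes, kernels of characters) is settled by `decide`; `exists_blocks`
is stated for an arbitrary `ℚ`-algebra `L` that is a field (all `Algebra ℚ L` instances agree;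
`convert` at the call site).

## References

* T. Dokchitser, V. Dokchitser, *A note on the Mordell–Weil rank modulo `n`*, J. Number Theory
  131 (2011) 1833–1839, arXiv:0910.4588: Thm. 2, Lemma 5 (the twist mechanism over a fixed field,
  printed for quadratic twists), §2 first paragraph. [DokchitserDokchitser2011RankModN]
* J. H. Silverman, *The Arithmetic of Elliptic Curves*, 2nd ed., GTM 106 (2009): X.5 Prop. 5.4 and
  Cor. 5.4.1 (twists of `j = 0` curves by `K^×/K^{×6}`), III.1 (admissible changes of variables
  `(x, y) ↦ (u²x, u³y)`). [SilvermanAEC2009]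
* J.-P. Serre, *A Course in Arithmetic*, GTM 7 (1973), Ch. II §2.2 (Hensel: lifting simple roots).
  [Serre1973]
-/

noncomputable section

open scoped Classical

namespace Literature.Barriers.BirchSwinnertonDyer

namespace CubicTwist

open WeierstrassCurve Literature.NumberTheory.EllipticCurves Polynomial

/-! ### The index group `ℤ/3 × ℤ/3`, the parameters `t(a,b) = 2^a 5^b`, characters, block maps -/

/-- Indices of the nine cubic twists: `(a, b) ∈ ℤ/3 × ℤ/3` stands for
`t = 2^a 5^b ∈ ⟨2, 5⟩ ⊂ ℚ^×/ℚ^{×3}`. [folklore] -/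
abbrev Idx : Type := ZMod 3 × ZMod 3

/-- The parameter `t(a, b) = 2^a 5^b ∈ ℕ` (exponents read in `{0, 1, 2}`). [folklore] -/
def param (D : Idx) : ℕ := 2 ^ D.1.val * 5 ^ D.2.val

/-- `t(D) ≠ 0`. [folklore] -/
theorem param_ne_zero (D : Idx) : param D ≠ 0 := by
  unfold param; positivity

/-- Carry in the `2`-exponent when adding indices. [folklore] -/
def carry₂ (A B : Idx) : ℕ := if A.1.val + B.1.val < 3 then 0 else 1

/-- Carry in the `5`-exponent when adding indices. [folklore] -/
def carry₅ (A B : Idx) : ℕ := if A.2.val + B.2.val < 3 then 0 else 1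

/-- `t` is multiplicative up to the cubes `8`, `125`: `t(A) t(B) = t(A + B) 8^ε 125^η`. [folklore] -/
theorem param_mul_param (A B : Idx) :
    param A * param B = param (A + B) * 8 ^ carry₂ A B * 125 ^ carry₅ A B := by
  revert A B; decide

/-- The characters `χ_c(D) = c₁ a + c₂ b` of the index group. [folklore] -/
def chi (c D : Idx) : ZMod 3 := c.1 * D.1 + c.2 * D.2

/-- A representative of the coset `{χ_c = i}` (for `c ≠ 0`). [folklore] -/
def rep (c : Idx) (i : ZMod 3) : Idx := if c.1 ≠ 0 then (i * c.1, 0) else (0, i * c.2)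

/-- The block map: `D ↦` the chosen representative of its coset modulo `ker χ_c`. [folklore] -/
def blockMap (c D : Idx) : Idx := rep c (chi c D)

/-- Every fibre of a block map has cardinality divisible by `3` (`9, 0, …` for `c = 0`;
`3, 3, 3, 0, …` otherwise). [folklore] -/
theorem three_dvd_card_filter_blockMap (c j : Idx) :
    3 ∣ (Finset.univ.filter fun D ↦ blockMap c D = j).card := by
  revert c j; decide

/-- `D` and its block representative lie in the same coset of `ker χ_c`. [folklore] -/
theorem chi_sub_blockMap (c D : Idx) : chi c (D - blockMap c D) = 0 := by
  revert c D; decide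

/-- The kernel of `χ_{(e₂, 2e₁)}` is the line `{0, e, 2e}` through `e ≠ 0`. [folklore] -/
theorem ker_chi_line (e D : Idx) (he : e ≠ 0) (h : chi (e.2, 2 * e.1) D = 0) :
    D = 0 ∨ D = e ∨ D = e + e := by
  revert e D; decide

/-! ### The nine curves `E_D : y² = x³ + t(D)²` -/

/-- **The cubic twist family** `E_D : y² = x³ + t(D)²`, `t(a,b) = 2^a 5^b`, over `ℚ` (the Mordell
curves `mordellCurve (t²)`; all have the rational point `(0, t)` of order `3` and `j = 0`).
[cite: SilvermanAEC2009, X.5 Prop. 5.4] -/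
def curve (D : Idx) : WeierstrassCurve ℚ := mordellCurve ((param D : ℚ) ^ 2)

/-- Each `E_D` is an elliptic curve (`Δ = −432 t⁴ ≠ 0`). [folklore] -/
instance curve.instIsElliptic (D : Idx) : (curve D).IsElliptic :=
  isElliptic_mordellCurve (pow_ne_zero 2 (Nat.cast_ne_zero.mpr (param_ne_zero D)))

section Iso

variable (L : Type*) [Field L] [Algebra ℚ L]

/-- Base change of `E_D` to a `ℚ`-algebra: `y² = x³ + t(D)²` read in `L`. [folklore] -/
theorem curve_baseChange (D : Idx) : (curve D).baseChange L = mordellCurve ((param D : L) ^ 2) := by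
  rw [curve, mordellCurve_baseChange, map_pow, map_natCast]

/-- **`E_{D'} ≅ E_D` over `L` when `t(D) = t(D') r³` in `L`**: the change of variables
`(x, y) ↦ (r² x, r³ y)` (`u = r⁻¹`) multiplies `a₆ = t(D')²` by `r⁶`. The easy half of Silverman
X.5.4 for `j = 0` (`y² = x³ + s` depends on `s` modulo `L^{×6}`).
[cite: SilvermanAEC2009, X.5 Prop. 5.4] -/
theorem exists_variableChange (D D' : Idx) {r : L} (hr : r ≠ 0)
    (h : (param D : L) = (param D' : L) * r ^ 3) :
    ∃ C : VariableChange L, C • (curve D').baseChange L = (curve D).baseChange L := by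
  refine ⟨⟨(Units.mk0 r hr)⁻¹, 0, 0, 0⟩, ?_⟩
  rw [curve_baseChange, curve_baseChange]
  ext
  · simp [variableChange_a₁, mordellCurve]
  · simp [variableChange_a₂, mordellCurve]
  · simp [variableChange_a₃, mordellCurve]
  · simp [variableChange_a₄, mordellCurve]
  · simp only [variableChange_a₆, mordellCurve_a₁, mordellCurve_a₃, mordellCurve_a₄,
      mordellCurve_a₂, mordellCurve_a₆, inv_inv, Units.val_mk0, h]
    ring

/-- Products and quotients by rational cubes of cubes are cubes: if `t(K) = r³` (`r ≠ 0`) and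
`t(D') t(K) = t(D) 8^ε 125^η` then `t(D) = t(D') r'³` for some `r' ≠ 0`. [folklore] -/
theorem param_eq_mul_cube {D D' K : Idx} {r : L} (hr : r ≠ 0) (hK : (param K : L) = r ^ 3)
    {ε η : ℕ} (h : param D' * param K = param D * 8 ^ ε * 125 ^ η) :
    ∃ r' : L, r' ≠ 0 ∧ (param D : L) = (param D' : L) * r' ^ 3 := by
  haveI : CharZero L := charZero_of_injective_algebraMap (algebraMap ℚ L).injective
  have h2 : (2 : L) ≠ 0 := two_ne_zero
  have h5 : (5 : L) ≠ 0 := by norm_num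
  refine ⟨r / (2 ^ ε * 5 ^ η), div_ne_zero hr (mul_ne_zero (pow_ne_zero _ h2) (pow_ne_zero _ h5)), ?_⟩
  have hL : (param D' : L) * (param K : L) = (param D : L) * 8 ^ ε * 125 ^ η := by
    exact_mod_cast h
  rw [hK, show (8 : L) = 2 ^ 3 by norm_num, show (125 : L) = 5 ^ 3 by norm_num, ← pow_mul,
    ← pow_mul] at hL
  field_simp
  rw [← pow_mul, ← pow_mul, mul_comm ε 3, mul_comm η 3]
  linear_combination -hL

/-- **Blocks.** If over the field `L ⊇ ℚ` the kernel of some character `χ_c` consists of indices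
`D` with `t(D) ∈ L^{×3}`, then the nine twists fall into blocks — the cosets of `ker χ_c`, of
size `3` or `9` — each consisting of `L`-isomorphic curves: the hypothesis format of
`not_isSumOfLocalInvariantsOver_of_blocks` with `n = 3`. [cite: DokchitserDokchitser2011RankModN, Lemma 5] -/
theorem exists_blocks (h : ∃ c : Idx, ∀ D, chi c D = 0 → ∃ r : L, r ≠ 0 ∧ (param D : L) = r ^ 3) :
    ∃ m : Idx → Idx,
      (∀ D, ∃ C : VariableChange L, C • (curve D).baseChange L = (curve (m D)).baseChange L) ∧
      ∀ j, 3 ∣ (Finset.univ.filter fun D ↦ m D = j).card := by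
  obtain ⟨c, hc⟩ := h
  refine ⟨blockMap c, fun D ↦ ?_, three_dvd_card_filter_blockMap c⟩
  obtain ⟨r, hr, hK⟩ := hc (D - blockMap c D) (chi_sub_blockMap c D)
  have hmul := param_mul_param (blockMap c D) (D - blockMap c D)
  rw [add_sub_cancel] at hmul
  -- `t(mD) t(D - mD) = t(D) 8^ε 125^η`, so `t(D) (2^ε 5^η / r)³ = t(mD)`
  obtain ⟨r', hr', h'⟩ := param_eq_mul_cube L (D := D) (D' := blockMap c D) hr hK
    (ε := carry₂ (blockMap c D) (D - blockMap c D)) (η := carry₅ (blockMap c D) (D - blockMap c D))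
    hmul
  refine exists_variableChange L (blockMap c D) D (inv_ne_zero hr') ?_
  rw [h', inv_pow, mul_assoc, mul_inv_cancel₀ (pow_ne_zero 3 hr'), mul_one]

end Iso

/-! ### Cubes in `ℚ_p`: Hensel's lemma for `X³ − n` -/

section Hensel

variable {p : ℕ} [hp : Fact p.Prime]

/-- **`p ≠ 3`: an integer congruent to the cube of a `p`-unit modulo `p` is a cube in `ℚ_p`**
(Hensel's lemma for `F = X³ − n`: `‖F(a)‖ < 1 = ‖F'(a)‖² = ‖3a²‖²`).
[cite: Serre1973, Ch. II §2.2] -/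
theorem padic_isCube_of_dvd (hp3 : p ≠ 3) {n a : ℤ} (ha : ¬ (p : ℤ) ∣ a)
    (h : (p : ℤ) ∣ a ^ 3 - n) : ∃ r : ℚ_[p], r ≠ 0 ∧ (n : ℚ_[p]) = r ^ 3 := by
  have hpZ : Prime (p : ℤ) := Nat.prime_iff_prime_int.mp hp.out
  set F : ℤ[X] := X ^ 3 - C n with hF
  have hFa : F.aeval (a : ℤ_[p]) = ((a ^ 3 - n : ℤ) : ℤ_[p]) := by
    simp [hF]
  have hF' : F.derivative = C 3 * X ^ 2 := by
    rw [hF, derivative_sub, derivative_X_pow, derivative_C, sub_zero]; norm_num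
  have hFa' : F.derivative.aeval (a : ℤ_[p]) = ((3 * a ^ 2 : ℤ) : ℤ_[p]) := by
    simp only [hF', map_mul, map_pow, aeval_X, map_ofNat]
    push_cast; ring
  have hn1 : ‖F.aeval (a : ℤ_[p])‖ < 1 := by
    rw [hFa]; exact (PadicInt.norm_int_lt_one_iff_dvd _).mpr h
  have hd1 : ‖F.derivative.aeval (a : ℤ_[p])‖ = 1 := by
    rw [hFa']
    refine le_antisymm (PadicInt.norm_le_one _) (not_lt.mp fun hlt ↦ ?_)
    have hdvd := (PadicInt.norm_int_lt_one_iff_dvd _).mp hlt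
    rcases hpZ.dvd_or_dvd hdvd with h3 | h2
    · have : (p : ℤ) ∣ 3 := h3
      have hp3' : p ∣ 3 := by exact_mod_cast this
      rcases (Nat.dvd_prime Nat.prime_three).mp hp3' with h1 | h1
      · exact hp.out.one_lt.ne' h1
      · exact hp3 h1
    · exact ha (hpZ.dvd_of_dvd_pow h2)
  have hnorm : ‖F.aeval (a : ℤ_[p])‖ < ‖F.derivative.aeval (a : ℤ_[p])‖ ^ 2 := by
    rw [hd1, one_pow]; exact hn1
  obtain ⟨z, hz, -⟩ := hensels_lemma hnorm
  have hz3 : (z : ℚ_[p]) ^ 3 = (n : ℚ_[p]) := by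
    have : F.aeval z = z ^ 3 - (n : ℤ_[p]) := by simp [hF]
    rw [this, sub_eq_zero] at hz
    have := congrArg ((↑) : ℤ_[p] → ℚ_[p]) hz
    push_cast at this
    exact this
  have hn0 : (n : ℚ_[p]) ≠ 0 := by
    intro h0
    have hn : n = 0 := by exact_mod_cast h0
    rw [hn, sub_zero] at h
    exact ha (hpZ.dvd_of_dvd_pow h)
  refine ⟨z, fun h0 ↦ hn0 ?_, hz3.symm⟩
  rw [← hz3, h0]; ring

/-- **`p = 3`: an integer congruent modulo `27` to the cube of a `3`-unit is a cube in `ℚ₃`**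
(Hensel with `‖F(a)‖ ≤ 3⁻³ < 3⁻² = ‖3a²‖²`). [cite: Serre1973, Ch. II §2.2] -/
theorem padicThree_isCube_of_dvd {n a : ℤ} (ha : ¬ (3 : ℤ) ∣ a) (h : (27 : ℤ) ∣ a ^ 3 - n) :
    ∃ r : ℚ_[3], r ≠ 0 ∧ (n : ℚ_[3]) = r ^ 3 := by
  haveI : Fact (Nat.Prime 3) := ⟨Nat.prime_three⟩
  have h3Z : Prime (3 : ℤ) := by norm_num
  set F : ℤ[X] := X ^ 3 - C n with hF
  have hFa : F.aeval (a : ℤ_[3]) = ((a ^ 3 - n : ℤ) : ℤ_[3]) := by simp [hF]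
  have hF' : F.derivative = C 3 * X ^ 2 := by
    rw [hF, derivative_sub, derivative_X_pow, derivative_C, sub_zero]; norm_num
  have hFa' : F.derivative.aeval (a : ℤ_[3]) = (3 : ℤ_[3]) * ((a ^ 2 : ℤ) : ℤ_[3]) := by
    simp only [hF', map_mul, map_pow, aeval_X, map_ofNat]
    push_cast; ring
  have hn1 : ‖F.aeval (a : ℤ_[3])‖ ≤ (3 : ℝ) ^ (-3 : ℤ) := by
    rw [hFa]
    have : ((3 : ℕ) ^ 3 : ℤ) ∣ a ^ 3 - n := by norm_num; exact h
    have h' := (PadicInt.norm_int_le_pow_iff_dvd (p := 3) (k := a ^ 3 - n) (n := 3)).mpr this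
    exact_mod_cast h'
  have ha2 : ‖((a ^ 2 : ℤ) : ℤ_[3])‖ = 1 := by
    refine le_antisymm (PadicInt.norm_le_one _) (not_lt.mp fun hlt ↦ ?_)
    have hdvd := (PadicInt.norm_int_lt_one_iff_dvd _).mp hlt
    exact ha (h3Z.dvd_of_dvd_pow (by exact_mod_cast hdvd))
  have hd : ‖F.derivative.aeval (a : ℤ_[3])‖ = (3 : ℝ)⁻¹ := by
    rw [hFa', norm_mul, ha2, mul_one]
    exact_mod_cast PadicInt.norm_p (p := 3)
  have hnorm : ‖F.aeval (a : ℤ_[3])‖ < ‖F.derivative.aeval (a : ℤ_[3])‖ ^ 2 := by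
    rw [hd]
    refine lt_of_le_of_lt hn1 ?_
    norm_num
  obtain ⟨z, hz, -⟩ := hensels_lemma hnorm
  have hz3 : (z : ℚ_[3]) ^ 3 = (n : ℚ_[3]) := by
    have : F.aeval z = z ^ 3 - (n : ℤ_[3]) := by simp [hF]
    rw [this, sub_eq_zero] at hz
    have := congrArg ((↑) : ℤ_[3] → ℚ_[3]) hz
    push_cast at this
    exact this
  have hn0 : (n : ℚ_[3]) ≠ 0 := by
    intro h0
    have hn : n = 0 := by exact_mod_cast h0
    rw [hn, sub_zero] at h
    exact ha (h3Z.dvd_of_dvd_pow (dvd_trans (by norm_num) h))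
  refine ⟨z, fun h0 ↦ hn0 ?_, hz3.symm⟩
  rw [← hz3, h0]; ring

end Hensel

/-! ### Cyclicity of `𝔽_p^×`: among `x, y, xy, xy²` one is a cube -/

/-- In the cyclic group `𝔽_p^×`, for any `x, y` one of `x`, `y`, `xy`, `xy²` is a cube (write
`x = g^i`, `y = g^j`; one of `i, j, i + j, i + 2j` is divisible by `3`). Equivalently: the image of
`⟨x, y⟩` in `𝔽_p^×/𝔽_p^{×3}` (a cyclic group of exponent `3`) has order `≤ 3`. [folklore] -/
theorem exists_cube_combination {p : ℕ} [Fact p.Prime] (x y : (ZMod p)ˣ) :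
    ∃ e : Idx, e ≠ 0 ∧ ∃ z : (ZMod p)ˣ, x ^ e.1.val * y ^ e.2.val = z ^ 3 := by
  obtain ⟨g, hg⟩ := exists_zpow_surjective (ZMod p)ˣ
  obtain ⟨i, rfl⟩ := hg x
  obtain ⟨j, rfl⟩ := hg y
  have key : ∀ k : ℤ, 3 ∣ k → ∃ z : (ZMod p)ˣ, g ^ k = z ^ 3 := by
    rintro k ⟨m, rfl⟩
    exact ⟨g ^ m, by rw [mul_comm, zpow_mul]; norm_cast⟩
  have H : 3 ∣ i ∨ 3 ∣ j ∨ 3 ∣ i + j ∨ 3 ∣ i + 2 * j := by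
    rcases (by omega : i % 3 = 0 ∨ i % 3 = 1 ∨ i % 3 = 2) with hi | hi | hi <;>
    rcases (by omega : j % 3 = 0 ∨ j % 3 = 1 ∨ j % 3 = 2) with hj | hj | hj <;>
    first
    | exact Or.inl (Int.dvd_of_emod_eq_zero (by omega))
    | exact Or.inr (Or.inl (Int.dvd_of_emod_eq_zero (by omega)))
    | exact Or.inr (Or.inr (Or.inl (Int.dvd_of_emod_eq_zero (by omega))))
    | exact Or.inr (Or.inr (Or.inr (Int.dvd_of_emod_eq_zero (by omega))))
  rcases H with h | h | h | h
  · refine ⟨(1, 0), by decide, ?_⟩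
    simpa [ZMod.val_one] using key i h
  · refine ⟨(0, 1), by decide, ?_⟩
    simpa [ZMod.val_one] using key j h
  · refine ⟨(1, 1), by decide, ?_⟩
    obtain ⟨z, hz⟩ := key _ h
    refine ⟨z, ?_⟩
    simpa [ZMod.val_one, zpow_add] using hz
  · refine ⟨(1, 2), by decide, ?_⟩
    obtain ⟨z, hz⟩ := key _ h
    refine ⟨z, ?_⟩
    have h2 : (2 : ZMod 3).val = 2 := rfl
    simp only [ZMod.val_one, h2, pow_one]
    rw [sq, ← zpow_add, ← zpow_add, show i + (j + j) = i + 2 * j by ring]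
    exact hz

/-! ### The local kernels: at every place a subgroup of index `≤ 3` of `⟨2, 5⟩` consists of cubes -/

section Padic

/-- A prime `q ≠ p` is a unit modulo `p`. [folklore] -/
theorem natCast_zmod_ne_zero {p q : ℕ} [hp : Fact p.Prime] (hq : q.Prime) (hpq : p ≠ q) :
    (q : ZMod p) ≠ 0 := by
  rw [Ne, ZMod.natCast_eq_zero_iff, Nat.prime_dvd_prime_iff_eq hp.out hq]
  exact hpq

/-- **Primes `p ∉ {2, 3, 5}`**: the set of `D` with `t(D)` a cube in `ℚ_p` contains the kernel of
some character `χ_c` — by cyclicity of `𝔽_p^×` one of `2, 5, 10, 50` is a non-zero cube modulo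
`p`, say `t(e)`, which Hensel lifts; then the line `{0, e, 2e} = ker χ_{(e₂, 2e₁)}` consists of
cubes. [cite: Serre1973, Ch. II §2.2] -/
theorem padic_ker_isCube_of_ne (p : ℕ) [hp : Fact p.Prime] (hp2 : p ≠ 2) (hp3 : p ≠ 3)
    (hp5 : p ≠ 5) : ∃ c : Idx, ∀ D, chi c D = 0 → ∃ r : ℚ_[p], r ≠ 0 ∧ (param D : ℚ_[p]) = r ^ 3 := by
  have h2 : (2 : ZMod p) ≠ 0 := by exact_mod_cast natCast_zmod_ne_zero Nat.prime_two hp2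
  have h5 : (5 : ZMod p) ≠ 0 := by
    exact_mod_cast natCast_zmod_ne_zero (by norm_num : Nat.Prime 5) hp5
  obtain ⟨e, he, z, hz⟩ := exists_cube_combination (Units.mk0 (2 : ZMod p) h2) (Units.mk0 5 h5)
  -- `t(e) ≡ z³ (mod p)` with `z` a unit
  have hze : ((param e : ℤ) : ZMod p) = (z : ZMod p) ^ 3 := by
    have := congrArg (Units.val) hz
    push_cast [param] at this ⊢
    simpa using this
  set a : ℤ := ((z : ZMod p).val : ℤ) with ha
  have haz : ((a : ℤ) : ZMod p) = (z : ZMod p) := by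
    rw [ha, Int.cast_natCast, ZMod.natCast_zmod_val]
  have hpa : ¬ (p : ℤ) ∣ a := by
    intro hd
    have : ((a : ℤ) : ZMod p) = 0 := (ZMod.intCast_zmod_eq_zero_iff_dvd a p).mpr hd
    rw [haz] at this
    exact z.ne_zero this
  have hcube : ∃ r : ℚ_[p], r ≠ 0 ∧ ((param e : ℤ) : ℚ_[p]) = r ^ 3 := by
    refine padic_isCube_of_dvd hp3 hpa ?_
    rw [← ZMod.intCast_zmod_eq_zero_iff_dvd]
    push_cast
    rw [haz, ← hze]; push_cast; ring
  obtain ⟨r, hr, hre⟩ := hcube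
  have hre' : (param e : ℚ_[p]) = r ^ 3 := by exact_mod_cast hre
  refine ⟨(e.2, 2 * e.1), fun D hD ↦ ?_⟩
  rcases ker_chi_line e D he hD with rfl | rfl | rfl
  · exact ⟨1, one_ne_zero, by simp [param]⟩
  · exact ⟨r, hr, hre'⟩
  · -- `t(e) t(e) = t(2e) 8^ε 125^η`
    have hmul := param_mul_param e e
    obtain ⟨r', hr', h'⟩ := param_eq_mul_cube ℚ_[p] (D := e + e) (D' := e) (K := e) hr hre'
      (ε := carry₂ e e) (η := carry₅ e e) (by rw [hmul])
    exact ⟨r * r', mul_ne_zero hr hr', by rw [h', hre']; ring⟩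

/-- **`p = 2`**: `5 = r³` in `ℚ₂` (`5 ≡ 1³ mod 2`), so the kernel `{a = 0}` of `χ_{(1,0)}`
(`t = 5^b`) consists of cubes. [cite: Serre1973, Ch. II §2.2] -/
theorem padic_ker_isCube_two :
    ∃ c : Idx, ∀ D, chi c D = 0 → ∃ r : ℚ_[2], r ≠ 0 ∧ (param D : ℚ_[2]) = r ^ 3 := by
  haveI : Fact (Nat.Prime 2) := ⟨Nat.prime_two⟩
  obtain ⟨r, hr, h5⟩ := padic_isCube_of_dvd (p := 2) (by norm_num) (n := 5) (a := 1)
    (by norm_num) (by norm_num)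
  refine ⟨(1, 0), fun D hD ↦ ?_⟩
  have hD1 : D.1 = 0 := by simpa [chi] using hD
  refine ⟨r ^ D.2.val, pow_ne_zero _ hr, ?_⟩
  have h5' : (5 : ℚ_[2]) = r ^ 3 := by exact_mod_cast h5
  rw [param, hD1, ZMod.val_zero, pow_zero, one_mul]
  push_cast
  rw [h5', ← pow_mul, ← pow_mul, mul_comm]

/-- **`p = 5`**: `2 = r³` in `ℚ₅` (`2 ≡ 3³ mod 5`), so the kernel `{b = 0}` of `χ_{(0,1)}`
(`t = 2^a`) consists of cubes. [cite: Serre1973, Ch. II §2.2] -/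
theorem padic_ker_isCube_five [Fact (Nat.Prime 5)] :
    ∃ c : Idx, ∀ D, chi c D = 0 → ∃ r : ℚ_[5], r ≠ 0 ∧ (param D : ℚ_[5]) = r ^ 3 := by
  obtain ⟨r, hr, h2⟩ := padic_isCube_of_dvd (p := 5) (by norm_num) (n := 2) (a := 3)
    (by norm_num) (by norm_num)
  refine ⟨(0, 1), fun D hD ↦ ?_⟩
  have hD2 : D.2 = 0 := by simpa [chi] using hD
  refine ⟨r ^ D.1.val, pow_ne_zero _ hr, ?_⟩
  have h2' : (2 : ℚ_[5]) = r ^ 3 := by exact_mod_cast h2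
  rw [param, hD2, ZMod.val_zero, pow_zero, mul_one]
  push_cast
  rw [h2', ← pow_mul, ← pow_mul, mul_comm]

/-- The kernel of `χ_{(1,2)}` is `{(0,0), (1,1), (2,2)}`, i.e. `t ∈ {1, 10, 100}`. [folklore] -/
theorem param_of_chi_one_two (D : Idx) (h : chi (1, 2) D = 0) :
    param D = 1 ∨ param D = 10 ∨ param D = 100 := by
  revert D; decide

/-- **`p = 3`**: `10 ≡ 4³` and `100 ≡ 7³ (mod 27)` are cubes in `ℚ₃`, so the kernel of
`χ_{(1,2)}` (`t ∈ {1, 10, 100}`, the `t ≡ 1 mod 9`) consists of cubes. [cite: Serre1973, Ch. II §2.2] -/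
theorem padic_ker_isCube_three [Fact (Nat.Prime 3)] :
    ∃ c : Idx, ∀ D, chi c D = 0 → ∃ r : ℚ_[3], r ≠ 0 ∧ (param D : ℚ_[3]) = r ^ 3 := by
  refine ⟨(1, 2), fun D hD ↦ ?_⟩
  rcases param_of_chi_one_two D hD with h | h | h <;> rw [h]
  · exact ⟨1, one_ne_zero, by simp⟩
  · obtain ⟨r, hr, h10⟩ := padicThree_isCube_of_dvd (n := 10) (a := 4) (by norm_num) (by norm_num)
    exact ⟨r, hr, by exact_mod_cast h10⟩
  · obtain ⟨r, hr, h100⟩ := padicThree_isCube_of_dvd (n := 100) (a := 7) (by norm_num) (by norm_num)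
    exact ⟨r, hr, by exact_mod_cast h100⟩

/-- **Every prime `p`**: some character of the index group has kernel consisting of `D` with
`t(D) ∈ ℚ_p^{×3}` — the image of `⟨2, 5⟩` in `ℚ_p^×/ℚ_p^{×3}` has order `≤ 3`, i.e. every local
multiplicity of the family `{E_D}` over `ℚ_p` is `3` or `9`. [cite: DokchitserDokchitser2011RankModN, Lemma 5] -/
theorem padic_ker_isCube (p : ℕ) [Fact p.Prime] :
    ∃ c : Idx, ∀ D, chi c D = 0 → ∃ r : ℚ_[p], r ≠ 0 ∧ (param D : ℚ_[p]) = r ^ 3 := by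
  by_cases hp2 : p = 2
  · subst hp2; exact padic_ker_isCube_two
  by_cases hp3 : p = 3
  · subst hp3; exact padic_ker_isCube_three
  by_cases hp5 : p = 5
  · subst hp5; exact padic_ker_isCube_five
  exact padic_ker_isCube_of_ne p hp2 hp3 hp5

/-- **The real place**: every `t(D) > 0` is a cube in `ℝ`, so the kernel of `χ_0` (everything)
consists of cubes. [folklore] -/
theorem real_ker_isCube :
    ∃ c : Idx, ∀ D, chi c D = 0 → ∃ r : ℝ, r ≠ 0 ∧ (param D : ℝ) = r ^ 3 := by
  refine ⟨0, fun D _ ↦ ⟨(param D : ℝ) ^ ((3 : ℕ)⁻¹ : ℝ), ?_, ?_⟩⟩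
  · exact (Real.rpow_pos_of_pos (by exact_mod_cast Nat.pos_of_ne_zero (param_ne_zero D)) _).ne'
  · rw [Real.rpow_inv_natCast_pow (by positivity) three_ne_zero]

end Padic

/-! ### Transport to the completions of `ℚ` and the conclusion -/

section Completions

open IsDedekindDomain NumberField

/-- Cubes are transported along ring homomorphisms of fields. [folklore] -/
theorem ker_isCube_map {K K' : Type*} [Field K] [Field K'] (f : K →+* K') {c : Idx}
    (h : ∀ D, chi c D = 0 → ∃ r : K, r ≠ 0 ∧ (param D : K) = r ^ 3) (D : Idx)
    (hD : chi c D = 0) : ∃ r : K', r ≠ 0 ∧ (param D : K') = r ^ 3 := by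
  obtain ⟨r, hr, hrD⟩ := h D hD
  exact ⟨f r, (map_ne_zero f).mpr hr, by rw [← map_pow, ← hrD, map_natCast]⟩

/-- **Finite places**: over `ℚ_v = v.adicCompletion ℚ` the kernel of some `χ_c` consists of `D`
with `t(D) ∈ ℚ_v^{×3}` — from `padic_ker_isCube` at the prime under `v`, along Mathlib's
`ℚ_[p] ≃ ℚ_v` (`Rat.HeightOneSpectrum.adicCompletion.padicEquiv`). [folklore] -/
theorem adicCompletion_ker_isCube (v : HeightOneSpectrum (𝓞 ℚ)) :
    ∃ c : Idx, ∀ D, chi c D = 0 →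
      ∃ r : v.adicCompletion ℚ, r ≠ 0 ∧ (param D : v.adicCompletion ℚ) = r ^ 3 := by
  haveI : Fact ((Rat.HeightOneSpectrum.primesEquiv (R := 𝓞 ℚ) v : ℕ)).Prime :=
    ⟨(Rat.HeightOneSpectrum.primesEquiv (R := 𝓞 ℚ) v).2⟩
  let f : ℚ_[(Rat.HeightOneSpectrum.primesEquiv (R := 𝓞 ℚ) v : ℕ)] →+* v.adicCompletion ℚ :=
    (Rat.HeightOneSpectrum.adicCompletion.padicEquiv (R := 𝓞 ℚ) v).symm.toAlgEquiv.toRingEquiv.toRingHom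
  obtain ⟨c, hc⟩ := padic_ker_isCube (Rat.HeightOneSpectrum.primesEquiv (R := 𝓞 ℚ) v : ℕ)
  exact ⟨c, ker_isCube_map f hc⟩

/-- **The infinite place**: over `w.Completion ≅ ℝ` every `t(D)` is a cube. [folklore] -/
theorem infinitePlace_ker_isCube (w : InfinitePlace ℚ) :
    ∃ c : Idx, ∀ D, chi c D = 0 → ∃ r : w.Completion, r ≠ 0 ∧ (param D : w.Completion) = r ^ 3 := by
  let f : ℝ →+* w.Completion :=
    (InfinitePlace.Completion.ringEquivRealOfIsReal (IsTotallyReal.isReal w)).symm.toRingHom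
  obtain ⟨c, hc⟩ := real_ker_isCube
  exact ⟨c, ker_isCube_map f hc⟩

end Completions

/-- **The cubic-twist mechanism over the fixed field `ℚ`, PROVED** (audit 2026-08-15 of the barrier
file, evasions (iv) / scope (b), "not carried out in this audit"): a `ℤ/3ℤ`-valued invariant `Λ` of
Weierstrass curves over `ℚ` which is a sum of local invariants over the places of `ℚ`
(`IsSumOfLocalInvariantsOver ℚ Λ`) satisfies `Σ_D Λ(E_D) = 0` over the nine cubic twists
`E_D : y² = x³ + (2^a 5^b)²` — at every finite place (`adicCompletion_ker_isCube`) and at the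
infinite place (`infinitePlace_ker_isCube`) the nine curves fall into `3`-blocks of isomorphic
curves (`exists_blocks`), and the barrier file's `not_isSumOfLocalInvariantsOver_of_blocks` counts
("each local term occurs a multiple of `n` times", the proof of Lemma 5 of loc. cit., there for
quadratic twists). Stated contrapositively. [cite: DokchitserDokchitser2011RankModN, Lemma 5] -/
theorem not_isSumOfLocalInvariantsOver_rat_of_sum_ne_zero (Λ : WeierstrassCurve ℚ → ZMod 3)
    (hΛ : ∑ D, Λ (curve D) ≠ 0) : ¬ IsSumOfLocalInvariantsOver ℚ Λ :=
  not_isSumOfLocalInvariantsOver_of_blocks ℚ Λ curve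
    (fun v ↦ by convert exists_blocks (v.adicCompletion ℚ) (adicCompletion_ker_isCube v))
    (fun w ↦ by convert exists_blocks w.Completion (infinitePlace_ker_isCube w)) hΛ

/-- **The K-uniform case `n = 3` of Theorem 2 of Dokchitser–Dokchitser (2011) from nine Mordell
curves over `ℚ`**: if the Mordell–Weil ranks of `y² = x³ + (2^a 5^b)²`, `a, b ∈ {0, 1, 2}`, do not
add up to `0` modulo `3`, then the Mordell–Weil rank modulo `3` is not a sum of local invariants
(one `λ` for all number fields, `IsSumOfLocalInvariants`): such a `λ` would in particular serve
`ℚ` (`IsSumOfLocalInvariants.over`), contradicting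
`not_isSumOfLocalInvariantsOver_rat_of_sum_ne_zero`. (The printed proof uses instead Lemma 3 and
`rk 480a1(F₃) = 1`.) [cite: DokchitserDokchitser2011RankModN, Thm. 2] -/
theorem not_isSumOfLocalInvariants_rankMod_three_of_sum_ne_zero
    (h : ((∑ D, (curve D).mordellWeilRank : ℕ) : ZMod 3) ≠ 0) :
    ¬ IsSumOfLocalInvariants (rankInvariant (ZMod 3)) := fun h' ↦
  not_isSumOfLocalInvariantsOver_rat_of_sum_ne_zero _ (by simpa [rankInvariant] using h) (h'.over ℚ)

end CubicTwist

end Literature.Barriers.BirchSwinnertonDyer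

end
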